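import Mathlib
import Summits.CriticalPhenomena.CardyFormulaZ2.Theorems.CardyMagicRigidityNestingRigidityUVTiltTransferInputs
import Summits.CriticalPhenomena.CardyFormulaZ2.Theorems.CardyMagicRigidityNestingRigidityUVExpMomentsCell
import HarnessLib

/-!
# Crux `NestingRigidity`, line `positive-cone-weight-doubling`: the untilted exponential moments of
# the UV statistic ([A] `uvExpMoments_latticeEnsembles`) REDUCED to the far part and the collar statistic

Crux `Summit.CriticalPhenomena.CardyFormulaZ2.Theses.CardyMagicRigidity.NestingRigidity`
(stmt-CriticalPhenomena-4835), line `positive-cone-weight-doubling`, registered helper [A]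
`uvExpMoments_latticeEnsembles`: all-order untilted exponential moments of `Θ + t·E_δ N` and of `Θ₂`
(`Θ = Σ_{u ∉ tower} θ_u`, `Θ₂ = Σ θ_u²`, cone cloud, both lattices).  With the EXACT untilted
identity `E_δ Θ = −t E_δ N` (`integral_uvPhase_latticeEnsembles`), the pathwise split
`Θ = Θ_F + Θ_B` into the FAR part (loops missing `A* = B̄(0, 1+2δ) ∖ B(0, r−2δ)`) and the BOUNDARY
part (…UVTiltTransfer), and the collar dominations `|Θ_B| ≤ |t| K`, `0 ≤ Θ₂,B ≤ t² K`
(…UVTiltTransferCollar / …UVTiltTransferInputs), this file proves (registered anchor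
`uvExpMoments_of_far_and_collar_bounds`, no cited fact, no definition) that [A] FOLLOWS from three
all-order exponential-moment inputs, for all small `r` and then all small meshes, constants uniform
in `r`:

* (F)  `E_δ exp(a (Θ_F − E_δ Θ_F)) ≤ C(a)` for every real `a` — the CENTRED far part (the multi-scale
  chessboard statistic: …UVExpMomentsCell / …Assembly / …Indep + exponential moments of big-loop
  counts, keystone K6 `expMoment_ncard_bigLoops_le`);
* (F₂) `E_δ exp(a Θ₂,F) ≤ C(a)` for every `a > 0` (`Θ₂,F = Σ_{far} θ_u² ≥ 0`, uncentred);
* (K)  `E_δ exp(a K) ≤ C(a)` for every `a > 0`, `K = Σ_{u ∈ C_r} φ_u + #X + Σ_{u ∈ C_1} ψ_u` the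
  (charge-free, nonnegative) COLLAR STATISTIC of `abs_uvPhaseBd_le_collar_latticeEnsembles`.

Proof: `Θ + t E_δ N = (Θ_F − EΘ_F) + (Θ_B − EΘ_B)` exactly; Cauchy–Schwarz (the generalised Hölder
`expMoment_sum_le_prod_latticeEnsembles` with weights `½, ½`); `|Θ_B − EΘ_B| ≤ |t|(K + E K)` and Jensen
`e^{a E K} ≤ E e^{aK}`; likewise `Θ₂ ≤ Θ₂,F + t² K`.  Integrability at fixed mesh is automatic (all
statistics are bounded at fixed `δ > 0`).
-/

noncomputable section

open MeasureTheory ProbabilityTheory Set Filter Metric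
open scoped Real Topology BigOperators

namespace Summit.CriticalPhenomena.CardyFormulaZ2.Cruxes.NestingRigidity.PositiveConeWeightDoubling

open Literature.Probability.RandomPlanarGeometry Literature.Probability.Percolation
  Literature.Probability.LatticeModels
open Summit.CriticalPhenomena.CardyFormulaZ2.Cruxes.NestingRigidity.RingCloudTomography

namespace UVExpMoments

/-! ## §1 Two pieces: Cauchy–Schwarz for exponential moments -/

/-- **Cauchy–Schwarz for exponential moments** on both lattice ensembles: if `E e^{2X₁} ≤ M` and
`E e^{2X₂} ≤ M` then `e^{X₁ + X₂}` is integrable with `E e^{X₁+X₂} ≤ M`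
(`expMoment_sum_le_prod_latticeEnsembles` over `Bool` with weights `½, ½`). -/
theorem integral_exp_add_le : ∀ E ∈ latticeEnsembles, ∀ (X₁ X₂ : E.Ω → ℝ) {M : ℝ},
    Measurable X₁ → Measurable X₂ →
    Integrable (fun ω ↦ Real.exp (2 * X₁ ω)) E.P → ∫ ω, Real.exp (2 * X₁ ω) ∂E.P ≤ M →
    Integrable (fun ω ↦ Real.exp (2 * X₂ ω)) E.P → ∫ ω, Real.exp (2 * X₂ ω) ∂E.P ≤ M →
    Integrable (fun ω ↦ Real.exp (X₁ ω + X₂ ω)) E.P ∧ ∫ ω, Real.exp (X₁ ω + X₂ ω) ∂E.P ≤ M := by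
  intro E hE X₁ X₂ M hm₁ hm₂ hi₁ hI₁ hi₂ hI₂
  set X : Bool → E.Ω → ℝ := fun b ↦ if b then X₁ else X₂ with hX
  have hdiv : ∀ b ω, X b ω / (1 / 2 : ℝ) = 2 * X b ω := fun b ω ↦ by ring
  have hXm : ∀ b ∈ (Finset.univ : Finset Bool), Measurable (X b) := by
    rintro (_ | _) _
    · exact hm₂
    · exact hm₁
  have hint : ∀ b ∈ (Finset.univ : Finset Bool), Integrable (fun ω ↦ Real.exp (X b ω / (1 / 2 : ℝ))) E.P := by
    rintro (_ | _) _
    · simp_rw [hdiv]; exact hi₂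
    · simp_rw [hdiv]; exact hi₁
  obtain ⟨hI, hle⟩ := expMoment_sum_le_prod_latticeEnsembles E hE Bool Finset.univ X (fun _ ↦ 1 / 2)
    (fun _ _ ↦ by norm_num) (by simp) hXm hint
  simp only [Fintype.sum_bool, Fintype.prod_bool, hX, Bool.false_eq_true, ↓reduceIte] at hI hle
  refine ⟨hI, hle.trans ?_⟩
  have hM0 : 0 ≤ M := (integral_nonneg fun ω ↦ (Real.exp_pos _).le).trans hI₁
  have h1 : (∫ ω, Real.exp (X₁ ω / (1 / 2)) ∂E.P) ^ (1 / 2 : ℝ) ≤ M ^ (1 / 2 : ℝ) :=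
    Real.rpow_le_rpow (integral_nonneg fun ω ↦ (Real.exp_pos _).le)
      (by simp_rw [show ∀ ω, X₁ ω / (1 / 2 : ℝ) = 2 * X₁ ω from fun ω ↦ by ring]; exact hI₁) (by norm_num)
  have h2 : (∫ ω, Real.exp (X₂ ω / (1 / 2)) ∂E.P) ^ (1 / 2 : ℝ) ≤ M ^ (1 / 2 : ℝ) :=
    Real.rpow_le_rpow (integral_nonneg fun ω ↦ (Real.exp_pos _).le)
      (by simp_rw [show ∀ ω, X₂ ω / (1 / 2 : ℝ) = 2 * X₂ ω from fun ω ↦ by ring]; exact hI₂) (by norm_num)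
  calc (∫ ω, Real.exp (X₁ ω / (1 / 2)) ∂E.P) ^ (1 / 2 : ℝ) * (∫ ω, Real.exp (X₂ ω / (1 / 2)) ∂E.P) ^ (1 / 2 : ℝ)
      ≤ M ^ (1 / 2 : ℝ) * M ^ (1 / 2 : ℝ) :=
        mul_le_mul h1 h2 (Real.rpow_nonneg (integral_nonneg fun ω ↦ (Real.exp_pos _).le) _)
          (Real.rpow_nonneg hM0 _)
    _ = M := by rw [← Real.rpow_add' hM0 (by norm_num)]; norm_num

/-- At a fixed mesh a BOUNDED measurable statistic has all exponential moments (probability law). -/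
theorem integrable_exp_of_abs_le : ∀ E ∈ latticeEnsembles, ∀ (Z : E.Ω → ℝ) (a B : ℝ), Measurable Z →
    (∀ ω, |Z ω| ≤ B) → Integrable (fun ω ↦ Real.exp (a * Z ω)) E.P := by
  intro E hE Z a B hZm hB
  haveI := isProbabilityMeasure_of_mem hE
  refine Integrable.of_bound (Real.measurable_exp.comp (hZm.const_mul a)).aestronglyMeasurable
    (Real.exp (|a| * B)) (Eventually.of_forall fun ω ↦ ?_)
  rw [Real.norm_eq_abs, abs_of_pos (Real.exp_pos _), Real.exp_le_exp]
  calc a * Z ω ≤ |a * Z ω| := le_abs_self _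
    _ = |a| * |Z ω| := abs_mul _ _
    _ ≤ |a| * B := mul_le_mul_of_nonneg_left (hB ω) (abs_nonneg a)

/-- **Jensen at a fixed mesh**: `exp(a E_δ Z) ≤ E_δ e^{aZ}` for a bounded measurable `Z`. -/
theorem exp_mul_integral_le : ∀ E ∈ latticeEnsembles, ∀ (Z : E.Ω → ℝ) (a B : ℝ), Measurable Z →
    (∀ ω, |Z ω| ≤ B) → Real.exp (a * ∫ ω, Z ω ∂E.P) ≤ ∫ ω, Real.exp (a * Z ω) ∂E.P := by
  intro E hE Z a B hZm hB
  haveI := isProbabilityMeasure_of_mem hE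
  have hZi : Integrable Z E.P := Integrable.of_bound hZm.aestronglyMeasurable B
    (Eventually.of_forall fun ω ↦ by rw [Real.norm_eq_abs]; exact hB ω)
  rw [← integral_const_mul]
  exact exp_integral_le_integral_exp (hZi.const_mul a) (integrable_exp_of_abs_le E hE Z a B hZm hB)

end UVExpMoments

set_option maxHeartbeats 400000 in
/-- **[A] `uvExpMoments_latticeEnsembles` from the far part and the collar statistic** (registered
helper, line `positive-cone-weight-doubling`; both lattices).  For `E ∈ latticeEnsembles`: IF
(F) for every charge `t` in the cone and EVERY REAL `a`, for all small `r` and then all small meshes,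
the CENTRED FAR PART `Θ_F = Σ_{u ∈ X_δ, trace u ∩ A* = ∅} θ_u` (`A* = B̄(0, 1+2δ) ∖ B(0, r−2δ)`) has
`E_δ exp(a(Θ_F − E_δ Θ_F)) ≤ C`; (F₂) for every `a > 0`, `E_δ exp(a Σ_{far} θ_u²) ≤ C`; and (K) for
every `a > 0` the collar statistic `K = Σ_{u ∈ C_r} φ_u + #X + Σ_{u ∈ C_1} ψ_u` has `E_δ exp(a K) ≤ C`
— THEN the registered statement [A] holds verbatim: all-order untilted exponential moments of
`Θ + t·E_δ N`, of `−(Θ + t·E_δ N)` and of `Θ₂`, with constants uniform in `r`.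
(`Θ + t E_δ N = (Θ_F − EΘ_F) + (Θ_B − EΘ_B)` by the exact identity `E_δ Θ = −t E_δ N`;
Cauchy–Schwarz; `|Θ_B − EΘ_B| ≤ |t|(K + EK)`, `Θ₂ ≤ Θ₂,F + t²K`, Jensen `e^{aEK} ≤ E e^{aK}`.) -/
theorem uvExpMoments_of_far_and_collar_bounds : ∀ E ∈ latticeEnsembles,
    (∀ t ∈ Set.Ioo (-(π / 6)) (π / 6), ∀ a : ℝ, ∃ C r₀ : ℝ, 0 < r₀ ∧ ∀ r ∈ Set.Ioo (0 : ℝ) r₀,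
      ∀ᶠ δ in 𝓝[>] (0 : ℝ),
        ∫ ω, Real.exp (a * ((∑ᶠ u ∈ {u ∈ (E.X δ ω).loops |
            Disjoint u.range (Metric.closedBall (0 : ℂ) (1 + 2 * δ) \ Metric.ball 0 (r - 2 * δ))},
            u.nestingPhase (coneCloud t r).density) -
          ∫ ω', (∑ᶠ u ∈ {u ∈ (E.X δ ω').loops |
            Disjoint u.range (Metric.closedBall (0 : ℂ) (1 + 2 * δ) \ Metric.ball 0 (r - 2 * δ))},
            u.nestingPhase (coneCloud t r).density) ∂E.P)) ∂E.P ≤ C) →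
    (∀ t ∈ Set.Ioo (-(π / 6)) (π / 6), ∀ a : ℝ, 0 < a → ∃ C r₀ : ℝ, 0 < r₀ ∧ ∀ r ∈ Set.Ioo (0 : ℝ) r₀,
      ∀ᶠ δ in 𝓝[>] (0 : ℝ),
        ∫ ω, Real.exp (a * ∑ᶠ u ∈ {u ∈ (E.X δ ω).loops |
            Disjoint u.range (Metric.closedBall (0 : ℂ) (1 + 2 * δ) \ Metric.ball 0 (r - 2 * δ))},
            u.nestingPhase (coneCloud t r).density ^ 2) ∂E.P ≤ C) →
    (∀ a : ℝ, 0 < a → ∃ C r₀ : ℝ, 0 < r₀ ∧ ∀ r ∈ Set.Ioo (0 : ℝ) r₀, ∀ᶠ δ in 𝓝[>] (0 : ℝ),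
      ∫ ω, Real.exp (a * ((∑ᶠ u ∈ {u ∈ (E.X δ ω).loops |
            (u.range ∩ Metric.closedBall (0 : ℂ) r).Nonempty ∧ ¬ u.range ⊆ Metric.ball (0 : ℂ) (r - 2 * δ)},
            ∫ z in {z | u.wind z ≠ 0}, discDensity 0 r z) +
        ({u ∈ (E.X δ ω).loops | Metric.closedBall (0 : ℂ) r ⊆ {z | u.wind z ≠ 0} ∧
            ¬ u.range ⊆ Metric.ball (0 : ℂ) 1 ∧
            (u.range ∩ Metric.closedBall (0 : ℂ) (1 + 2 * δ)).Nonempty}.ncard : ℝ) +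
        ∑ᶠ u ∈ {u ∈ (E.X δ ω).loops | (u.range ∩ Metric.closedBall (0 : ℂ) (1 + 2 * δ)).Nonempty ∧
            ¬ u.range ⊆ Metric.ball (0 : ℂ) 1}, ∫ z in {z | u.wind z ≠ 0}, annulusDensity 0 1 2 z)) ∂E.P ≤ C) →
    ∀ t ∈ Set.Ioo (-(π / 6)) (π / 6), ∀ s : ℝ, 0 < s → ∃ C r₀ : ℝ, 0 < r₀ ∧ ∀ r ∈ Set.Ioo (0 : ℝ) r₀,
      ∀ᶠ δ in 𝓝[>] (0 : ℝ), ∀ Θ Θ₂ : E.Ω → ℝ,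
        (∀ ω, Θ ω = ∑ᶠ u ∈ (E.X δ ω).loops \ {u ∈ (E.X δ ω).loops |
            Metric.closedBall (0 : ℂ) r ⊆ {z | u.wind z ≠ 0} ∧ u.range ⊆ Metric.ball (0 : ℂ) 1},
            u.nestingPhase (coneCloud t r).density) →
        (∀ ω, Θ₂ ω = ∑ᶠ u ∈ (E.X δ ω).loops \ {u ∈ (E.X δ ω).loops |
            Metric.closedBall (0 : ℂ) r ⊆ {z | u.wind z ≠ 0} ∧ u.range ⊆ Metric.ball (0 : ℂ) 1},
            u.nestingPhase (coneCloud t r).density ^ 2) →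
        Integrable (fun ω ↦ Real.exp (s * (Θ ω + t * meanTower E δ r))) E.P ∧
        ∫ ω, Real.exp (s * (Θ ω + t * meanTower E δ r)) ∂E.P ≤ C ∧
        Integrable (fun ω ↦ Real.exp (-(s * (Θ ω + t * meanTower E δ r)))) E.P ∧
        ∫ ω, Real.exp (-(s * (Θ ω + t * meanTower E δ r))) ∂E.P ≤ C ∧
        Integrable (fun ω ↦ Real.exp (s * Θ₂ ω)) E.P ∧
        ∫ ω, Real.exp (s * Θ₂ ω) ∂E.P ≤ C := by
  intro E hE hF hF2 hK t ht s hs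
  haveI := isProbabilityMeasure_of_mem hE
  -- the five inputs
  obtain ⟨C₁, r₁, hr₁, h₁⟩ := hF t ht (2 * s)
  obtain ⟨C₁', r₁', hr₁', h₁'⟩ := hF t ht (-(2 * s))
  have ha₂ : 0 < 2 * s * |t| + 1 := by positivity
  obtain ⟨C₂, r₂, hr₂, h₂⟩ := hK (2 * s * |t| + 1) ha₂
  obtain ⟨C₃, r₃, hr₃, h₃⟩ := hF2 t ht (2 * s) (by positivity)
  have ha₄ : 0 < 2 * s * t ^ 2 + 1 := by positivity
  obtain ⟨C₄, r₄, hr₄, h₄⟩ := hK (2 * s * t ^ 2 + 1) ha₄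
  set M : ℝ := max (max (max C₁ C₁') (max (C₂ * C₂) C₃)) C₄ with hM
  refine ⟨M, min (min (min r₁ r₁') (min r₂ r₃)) (min r₄ 1),
    lt_min (lt_min (lt_min hr₁ hr₁') (lt_min hr₂ hr₃)) (lt_min hr₄ one_pos), fun r hr ↦ ?_⟩
  have hr0 : 0 < r := hr.1
  have hr1 : r ≤ 1 := (hr.2.trans_le ((min_le_right _ _).trans (min_le_right _ _))).le
  have hrr₁ : r ∈ Set.Ioo 0 r₁ :=
    ⟨hr0, hr.2.trans_le ((min_le_left _ _).trans ((min_le_left _ _).trans (min_le_left _ _)))⟩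
  have hrr₁' : r ∈ Set.Ioo 0 r₁' :=
    ⟨hr0, hr.2.trans_le ((min_le_left _ _).trans ((min_le_left _ _).trans (min_le_right _ _)))⟩
  have hrr₂ : r ∈ Set.Ioo 0 r₂ :=
    ⟨hr0, hr.2.trans_le ((min_le_left _ _).trans ((min_le_right _ _).trans (min_le_left _ _)))⟩
  have hrr₃ : r ∈ Set.Ioo 0 r₃ :=
    ⟨hr0, hr.2.trans_le ((min_le_left _ _).trans ((min_le_right _ _).trans (min_le_right _ _)))⟩
  have hrr₄ : r ∈ Set.Ioo 0 r₄ := ⟨hr0, hr.2.trans_le ((min_le_right _ _).trans (min_le_left _ _))⟩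
  filter_upwards [h₁ r hrr₁, h₁' r hrr₁', h₂ r hrr₂, h₃ r hrr₃, h₄ r hrr₄, self_mem_nhdsWithin]
    with δ hδ₁ hδ₁' hδ₂ hδ₃ hδ₄ hδ
  rw [Set.mem_Ioi] at hδ
  intro Θ Θ₂ hΘ hΘ₂
  obtain rfl : Θ = fun ω ↦ ∑ᶠ u ∈ (E.X δ ω).loops \ {u ∈ (E.X δ ω).loops |
      Metric.closedBall (0 : ℂ) r ⊆ {z | u.wind z ≠ 0} ∧ u.range ⊆ Metric.ball (0 : ℂ) 1},
      u.nestingPhase (coneCloud t r).density := funext hΘ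
  obtain rfl : Θ₂ = fun ω ↦ ∑ᶠ u ∈ (E.X δ ω).loops \ {u ∈ (E.X δ ω).loops |
      Metric.closedBall (0 : ℂ) r ⊆ {z | u.wind z ≠ 0} ∧ u.range ⊆ Metric.ball (0 : ℂ) 1},
      u.nestingPhase (coneCloud t r).density ^ 2 := funext hΘ₂
  set m : ℝ := meanTower E δ r with hm
  set θ : UnbasedLoop ℂ → ℝ := fun u ↦ u.nestingPhase (coneCloud t r).density with hθ
  have habs : ∀ u, |θ u| ≤ |t| := fun u ↦
    ConeTilt.abs_cone_nestingPhase_le (𝔠 := coneCloud t r) rfl hr0 u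
  have hsupp : ∀ u : UnbasedLoop ℂ, u.nestingPhase (coneCloud t r).density = 0 → θ u = 0 :=
    fun _ h ↦ h
  have habs2 : ∀ u, |θ u ^ 2| ≤ t ^ 2 := fun u ↦ by
    rw [abs_pow, ← sq_abs t]
    exact pow_le_pow_left₀ (abs_nonneg _) (habs u) 2
  have hsupp2 : ∀ u : UnbasedLoop ℂ, u.nestingPhase (coneCloud t r).density = 0 → θ u ^ 2 = 0 :=
    fun _ h ↦ by simp only [hθ, h]; ring
  set DF : UnbasedLoop ℂ → Prop := fun u ↦
    Disjoint u.range (closedBall (0 : ℂ) (1 + 2 * δ) \ ball 0 (r - 2 * δ)) with hDF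
  set DB : UnbasedLoop ℂ → Prop := fun u ↦
    ¬ Disjoint u.range (closedBall (0 : ℂ) (1 + 2 * δ) \ ball 0 (r - 2 * δ)) ∧
      ¬ (closedBall (0 : ℂ) r ⊆ {z | u.wind z ≠ 0} ∧ u.range ⊆ ball (0 : ℂ) 1) with hDB
  set ΘF : E.Ω → ℝ := fun ω ↦ ∑ᶠ u ∈ {u ∈ (E.X δ ω).loops | DF u}, θ u with hΘF
  set ΘB : E.Ω → ℝ := fun ω ↦ ∑ᶠ u ∈ {u ∈ (E.X δ ω).loops | DB u}, θ u with hΘB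
  set Θ₂F : E.Ω → ℝ := fun ω ↦ ∑ᶠ u ∈ {u ∈ (E.X δ ω).loops | DF u}, θ u ^ 2 with hΘ₂F
  set Θ₂B : E.Ω → ℝ := fun ω ↦ ∑ᶠ u ∈ {u ∈ (E.X δ ω).loops | DB u}, θ u ^ 2 with hΘ₂B
  set Kf : E.Ω → ℝ := fun ω ↦
    (∑ᶠ u ∈ {u ∈ (E.X δ ω).loops | (u.range ∩ closedBall (0 : ℂ) r).Nonempty ∧
        ¬ u.range ⊆ ball (0 : ℂ) (r - 2 * δ)}, ∫ z in {z | u.wind z ≠ 0}, discDensity 0 r z) +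
      ({u ∈ (E.X δ ω).loops | closedBall (0 : ℂ) r ⊆ {z | u.wind z ≠ 0} ∧
        ¬ u.range ⊆ ball (0 : ℂ) 1 ∧
        (u.range ∩ closedBall (0 : ℂ) (1 + 2 * δ)).Nonempty}.ncard : ℝ) +
      ∑ᶠ u ∈ {u ∈ (E.X δ ω).loops | (u.range ∩ closedBall (0 : ℂ) (1 + 2 * δ)).Nonempty ∧
        ¬ u.range ⊆ ball (0 : ℂ) 1}, ∫ z in {z | u.wind z ≠ 0}, annulusDensity 0 1 2 z with hKf
  -- the pathwise splits and dominations
  have hsplit : ∀ ω, (∑ᶠ u ∈ (E.X δ ω).loops \ {u ∈ (E.X δ ω).loops |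
      closedBall (0 : ℂ) r ⊆ {z | u.wind z ≠ 0} ∧ u.range ⊆ ball (0 : ℂ) 1}, θ u) = ΘF ω + ΘB ω :=
    fun ω ↦ TiltTransfer.finsum_sdiff_tower_eq_far_add_bd_latticeEnsembles E hE hδ ω t hr0 hr1 θ hsupp
  have hsplit2 : ∀ ω, (∑ᶠ u ∈ (E.X δ ω).loops \ {u ∈ (E.X δ ω).loops |
      closedBall (0 : ℂ) r ⊆ {z | u.wind z ≠ 0} ∧ u.range ⊆ ball (0 : ℂ) 1}, θ u ^ 2) = Θ₂F ω + Θ₂B ω :=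
    fun ω ↦ TiltTransfer.finsum_sdiff_tower_eq_far_add_bd_latticeEnsembles E hE hδ ω t hr0 hr1
      (fun u ↦ θ u ^ 2) hsupp2
  have hBabs : ∀ ω, |ΘB ω| ≤ |t| * Kf ω := fun ω ↦
    abs_uvPhaseBd_le_collar_latticeEnsembles E hE hδ ω t hr0 hr1
  have hB2 : ∀ ω, Θ₂B ω ≤ t ^ 2 * Kf ω := fun ω ↦
    uvPhaseSqBd_le_collar_latticeEnsembles E hE hδ ω t hr0 hr1
  have hK0 : ∀ ω, 0 ≤ Kf ω := fun ω ↦ by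
    have h := hBabs ω
    rcases (abs_nonneg t).lt_or_eq with htpos | ht0
    · exact nonneg_of_mul_nonneg_right ((abs_nonneg _).trans h) htpos
    · exact add_nonneg (add_nonneg (finsum_nonneg fun u ↦ finsum_nonneg fun _ ↦
        (ConeTilt.setIntegral_discDensity_mem_Icc 0 hr0 _).1) (Nat.cast_nonneg _))
        (finsum_nonneg fun u ↦ finsum_nonneg fun _ ↦
          (ConeTilt.setIntegral_annulusDensity_mem_Icc 0 one_pos one_lt_two _).1)
  -- measurability and uniform bounds at the fixed mesh
  have hmF : Measurable ΘF := FirstMoment.measurable_finsum_loops_sep E hE δ DF θ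
  have hmB : Measurable ΘB := FirstMoment.measurable_finsum_loops_sep E hE δ DB θ
  have hmF2 : Measurable Θ₂F := FirstMoment.measurable_finsum_loops_sep E hE δ DF _
  have hmK : Measurable Kf := TiltTransfer.measurable_collar E hE δ r
  have hmΘ₂ : Measurable fun ω ↦ ∑ᶠ u ∈ (E.X δ ω).loops \ {u ∈ (E.X δ ω).loops |
      closedBall (0 : ℂ) r ⊆ {z | u.wind z ≠ 0} ∧ u.range ⊆ ball (0 : ℂ) 1}, θ u ^ 2 :=
    FirstMoment.measurable_finsum_loops_sdiff_sep E hE δ _ _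
  obtain ⟨BΘ, hBΘ⟩ := TiltTransfer.exists_abs_finsum_sep_le E hE hδ t hr0 hr1 θ (abs_nonneg t) habs hsupp
  obtain ⟨BΘ2, hBΘ2⟩ := TiltTransfer.exists_abs_finsum_sep_le E hE hδ t hr0 hr1 (fun u ↦ θ u ^ 2)
    (sq_nonneg t) habs2 hsupp2
  obtain ⟨BK, hBK⟩ := TiltTransfer.exists_abs_collar_le E hE hδ hr0 hr1
  have hFb : ∀ ω, |ΘF ω| ≤ BΘ := fun ω ↦ hBΘ ω DF
  have hBb : ∀ ω, |ΘB ω| ≤ BΘ := fun ω ↦ hBΘ ω DB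
  have hF2b : ∀ ω, |Θ₂F ω| ≤ BΘ2 := fun ω ↦ hBΘ2 ω DF
  have hKb : ∀ ω, |Kf ω| ≤ BK := fun ω ↦ hBK ω
  -- integrability of the pieces and the centring identity
  have hiF : Integrable ΘF E.P := Integrable.of_bound hmF.aestronglyMeasurable BΘ
    (Eventually.of_forall fun ω ↦ by rw [Real.norm_eq_abs]; exact hFb ω)
  have hiB : Integrable ΘB E.P := Integrable.of_bound hmB.aestronglyMeasurable BΘ
    (Eventually.of_forall fun ω ↦ by rw [Real.norm_eq_abs]; exact hBb ω)
  have hiK : Integrable Kf E.P := Integrable.of_bound hmK.aestronglyMeasurable BK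
    (Eventually.of_forall fun ω ↦ by rw [Real.norm_eq_abs]; exact hKb ω)
  set mF : ℝ := ∫ ω, ΘF ω ∂E.P with hmFdef
  set mB : ℝ := ∫ ω, ΘB ω ∂E.P with hmBdef
  set mK : ℝ := ∫ ω, Kf ω ∂E.P with hmKdef
  have hcentre : mF + mB = -t * m := by
    rw [hmFdef, hmBdef, ← integral_add hiF hiB, ← integral_uvPhase_latticeEnsembles E hE hδ t hr0 hr1]
    exact integral_congr_ae (Eventually.of_forall fun ω ↦ (hsplit ω).symm)
  have hmBabs : |mB| ≤ |t| * mK := by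
    calc |mB| ≤ ∫ ω, |ΘB ω| ∂E.P := abs_integral_le_integral_abs
      _ ≤ ∫ ω, |t| * Kf ω ∂E.P := integral_mono hiB.abs (hiK.const_mul _) hBabs
      _ = |t| * mK := integral_const_mul _ _
  have hmK0 : 0 ≤ mK := integral_nonneg hK0
  -- the centred boundary part is dominated by the collar statistic
  have hBcen : ∀ ω, |ΘB ω - mB| ≤ |t| * (Kf ω + mK) := fun ω ↦ by
    calc |ΘB ω - mB| ≤ |ΘB ω| + |mB| := abs_sub _ _
      _ ≤ |t| * Kf ω + |t| * mK := add_le_add (hBabs ω) hmBabs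
      _ = |t| * (Kf ω + mK) := by ring
  -- exponential moments of the collar statistic, Jensen
  have hJ : ∀ a : ℝ, Real.exp (a * mK) ≤ ∫ ω, Real.exp (a * Kf ω) ∂E.P := fun a ↦
    UVExpMoments.exp_mul_integral_le E hE Kf a BK hmK hKb
  have hδ₂' : ∫ ω, Real.exp ((2 * s * |t| + 1) * Kf ω) ∂E.P ≤ C₂ := hδ₂
  have hδ₄' : ∫ ω, Real.exp ((2 * s * t ^ 2 + 1) * Kf ω) ∂E.P ≤ C₄ := hδ₄
  have hC₂0 : 0 ≤ C₂ := (integral_nonneg fun ω ↦ (Real.exp_pos _).le).trans hδ₂'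
  have hMC₁ : C₁ ≤ M := le_max_of_le_left (le_max_of_le_left (le_max_left _ _))
  have hMC₁' : C₁' ≤ M := le_max_of_le_left (le_max_of_le_left (le_max_right _ _))
  have hMC₂ : C₂ * C₂ ≤ M := le_max_of_le_left (le_max_of_le_right (le_max_left _ _))
  have hMC₃ : C₃ ≤ M := le_max_of_le_left (le_max_of_le_right (le_max_right _ _))
  have hMC₄ : C₄ ≤ M := le_max_right _ _
  -- (B) the centred boundary part at the orders `±s`: `E e^{2σ(ΘB − mB)} ≤ C₂²` for `|σ| ≤ s`
  have hBexp : ∀ σ : ℝ, |σ| ≤ s →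
      Integrable (fun ω ↦ Real.exp (2 * (σ * (ΘB ω - mB)))) E.P ∧
        ∫ ω, Real.exp (2 * (σ * (ΘB ω - mB))) ∂E.P ≤ C₂ * C₂ := by
    intro σ hσ
    have hpt : ∀ ω, Real.exp (2 * (σ * (ΘB ω - mB))) ≤
        Real.exp ((2 * s * |t| + 1) * mK) * Real.exp ((2 * s * |t| + 1) * Kf ω) := by
      intro ω
      rw [← Real.exp_add, Real.exp_le_exp]
      have h1 : 2 * (σ * (ΘB ω - mB)) ≤ 2 * (s * (|t| * (Kf ω + mK))) := by
        have := hBcen ω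
        have h2 : σ * (ΘB ω - mB) ≤ |σ| * |ΘB ω - mB| := by
          rw [← abs_mul]; exact le_abs_self _
        nlinarith [abs_nonneg σ, abs_nonneg (ΘB ω - mB), mul_le_mul hσ this (abs_nonneg _) hs.le]
      nlinarith [hK0 ω, hmK0, abs_nonneg t]
    have hmeas : Measurable fun ω ↦ Real.exp (2 * (σ * (ΘB ω - mB))) :=
      Real.measurable_exp.comp (((hmB.sub_const _).const_mul σ).const_mul 2)
    have hmaj : Integrable (fun ω ↦ Real.exp ((2 * s * |t| + 1) * mK) *
        Real.exp ((2 * s * |t| + 1) * Kf ω)) E.P :=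
      (UVExpMoments.integrable_exp_of_abs_le E hE Kf _ BK hmK hKb).const_mul _
    have hint : Integrable (fun ω ↦ Real.exp (2 * (σ * (ΘB ω - mB)))) E.P :=
      hmaj.mono' hmeas.aestronglyMeasurable (Eventually.of_forall fun ω ↦ by
        rw [Real.norm_eq_abs, abs_of_pos (Real.exp_pos _)]; exact hpt ω)
    refine ⟨hint, ?_⟩
    calc ∫ ω, Real.exp (2 * (σ * (ΘB ω - mB))) ∂E.P
        ≤ ∫ ω, Real.exp ((2 * s * |t| + 1) * mK) * Real.exp ((2 * s * |t| + 1) * Kf ω) ∂E.P :=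
          integral_mono hint hmaj hpt
      _ = Real.exp ((2 * s * |t| + 1) * mK) * ∫ ω, Real.exp ((2 * s * |t| + 1) * Kf ω) ∂E.P :=
          integral_const_mul _ _
      _ ≤ C₂ * C₂ :=
          mul_le_mul ((hJ _).trans hδ₂') hδ₂' (integral_nonneg fun ω ↦ (Real.exp_pos _).le) hC₂0
  -- (F) the centred far part at the orders `±s`
  have hFexp : Integrable (fun ω ↦ Real.exp (2 * (s * (ΘF ω - mF)))) E.P ∧
      ∫ ω, Real.exp (2 * (s * (ΘF ω - mF))) ∂E.P ≤ C₁ := by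
    have e : (fun ω ↦ Real.exp (2 * (s * (ΘF ω - mF)))) = fun ω ↦ Real.exp (2 * s * (ΘF ω - mF)) := by
      funext ω; rw [mul_assoc]
    rw [e]
    exact ⟨UVExpMoments.integrable_exp_of_abs_le E hE (fun ω ↦ ΘF ω - mF) (2 * s) (BΘ + |mF|)
      (hmF.sub_const _) fun ω ↦ (abs_sub _ _).trans (add_le_add (hFb ω) le_rfl), hδ₁⟩
  have hFexp' : Integrable (fun ω ↦ Real.exp (2 * (-s * (ΘF ω - mF)))) E.P ∧
      ∫ ω, Real.exp (2 * (-s * (ΘF ω - mF))) ∂E.P ≤ C₁' := by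
    have e : (fun ω ↦ Real.exp (2 * (-s * (ΘF ω - mF)))) =
        fun ω ↦ Real.exp (-(2 * s) * (ΘF ω - mF)) := by
      funext ω; congr 1; ring
    rw [e]
    exact ⟨UVExpMoments.integrable_exp_of_abs_le E hE (fun ω ↦ ΘF ω - mF) (-(2 * s)) (BΘ + |mF|)
      (hmF.sub_const _) fun ω ↦ (abs_sub _ _).trans (add_le_add (hFb ω) le_rfl), hδ₁'⟩
  -- the centring identity in the form used below
  have hkey : ∀ (σ : ℝ) ω, σ * ((ΘF ω + ΘB ω) + t * m) = σ * (ΘF ω - mF) + σ * (ΘB ω - mB) := by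
    intro σ ω
    have : t * m = -(mF + mB) := by linarith [hcentre]
    rw [this]; ring
  -- (iii) preparation: `e^{sΘ₂} ≤ e^{sΘ₂,F + s t² K}` and Cauchy–Schwarz
  have hX₁ : Integrable (fun ω ↦ Real.exp (2 * (s * Θ₂F ω))) E.P ∧
      ∫ ω, Real.exp (2 * (s * Θ₂F ω)) ∂E.P ≤ M := by
    have e : (fun ω ↦ Real.exp (2 * (s * Θ₂F ω))) = fun ω ↦ Real.exp (2 * s * Θ₂F ω) := by
      funext ω; rw [mul_assoc]
    rw [e]
    exact ⟨UVExpMoments.integrable_exp_of_abs_le E hE Θ₂F (2 * s) BΘ2 hmF2 hF2b, hδ₃.trans hMC₃⟩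
  have hX₂ : Integrable (fun ω ↦ Real.exp (2 * (s * t ^ 2 * Kf ω))) E.P ∧
      ∫ ω, Real.exp (2 * (s * t ^ 2 * Kf ω)) ∂E.P ≤ M := by
    have e : (fun ω ↦ Real.exp (2 * (s * t ^ 2 * Kf ω))) = fun ω ↦ Real.exp ((2 * s * t ^ 2) * Kf ω) := by
      funext ω; congr 1; ring
    rw [e]
    refine ⟨UVExpMoments.integrable_exp_of_abs_le E hE Kf _ BK hmK hKb, le_trans ?_ (hδ₄'.trans hMC₄)⟩
    exact integral_mono (UVExpMoments.integrable_exp_of_abs_le E hE Kf _ BK hmK hKb)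
      (UVExpMoments.integrable_exp_of_abs_le E hE Kf _ BK hmK hKb) fun ω ↦
        Real.exp_le_exp.2 (by nlinarith [hK0 ω])
  obtain ⟨hI₃, hle₃⟩ := UVExpMoments.integral_exp_add_le E hE (fun ω ↦ s * Θ₂F ω)
    (fun ω ↦ s * t ^ 2 * Kf ω) (hmF2.const_mul s) (hmK.const_mul _) hX₁.1 hX₁.2 hX₂.1 hX₂.2
  have hpt : ∀ ω, Real.exp (s * ∑ᶠ u ∈ (E.X δ ω).loops \ {u ∈ (E.X δ ω).loops |
      closedBall (0 : ℂ) r ⊆ {z | u.wind z ≠ 0} ∧ u.range ⊆ ball (0 : ℂ) 1}, θ u ^ 2) ≤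
      Real.exp (s * Θ₂F ω + s * t ^ 2 * Kf ω) := fun ω ↦ by
    rw [Real.exp_le_exp]
    have e : (∑ᶠ u ∈ (E.X δ ω).loops \ {u ∈ (E.X δ ω).loops |
        closedBall (0 : ℂ) r ⊆ {z | u.wind z ≠ 0} ∧ u.range ⊆ ball (0 : ℂ) 1}, θ u ^ 2) ≤
        Θ₂F ω + t ^ 2 * Kf ω := by
      rw [hsplit2 ω]; exact add_le_add le_rfl (hB2 ω)
    calc s * (∑ᶠ u ∈ (E.X δ ω).loops \ {u ∈ (E.X δ ω).loops |
          closedBall (0 : ℂ) r ⊆ {z | u.wind z ≠ 0} ∧ u.range ⊆ ball (0 : ℂ) 1}, θ u ^ 2)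
        ≤ s * (Θ₂F ω + t ^ 2 * Kf ω) := mul_le_mul_of_nonneg_left e hs.le
      _ = s * Θ₂F ω + s * t ^ 2 * Kf ω := by ring
  obtain ⟨hI₁, hle₁⟩ := UVExpMoments.integral_exp_add_le E hE (fun ω ↦ s * (ΘF ω - mF))
    (fun ω ↦ s * (ΘB ω - mB)) ((hmF.sub_const _).const_mul s) ((hmB.sub_const _).const_mul s)
    hFexp.1 (hFexp.2.trans hMC₁) (hBexp s (abs_of_pos hs).le).1 ((hBexp s (abs_of_pos hs).le).2.trans hMC₂)
  obtain ⟨hI₂, hle₂⟩ := UVExpMoments.integral_exp_add_le E hE (fun ω ↦ -s * (ΘF ω - mF))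
    (fun ω ↦ -s * (ΘB ω - mB)) ((hmF.sub_const _).const_mul (-s)) ((hmB.sub_const _).const_mul (-s))
    hFexp'.1 (hFexp'.2.trans hMC₁') (hBexp (-s) (by rw [abs_neg, abs_of_pos hs])).1
    ((hBexp (-s) (by rw [abs_neg, abs_of_pos hs])).2.trans hMC₂)
  have e₁ : ∀ ω, Real.exp (s * ((∑ᶠ u ∈ (E.X δ ω).loops \ {u ∈ (E.X δ ω).loops |
      closedBall (0 : ℂ) r ⊆ {z | u.wind z ≠ 0} ∧ u.range ⊆ ball (0 : ℂ) 1}, θ u) + t * m)) =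
      Real.exp (s * (ΘF ω - mF) + s * (ΘB ω - mB)) := fun ω ↦ by rw [hsplit ω, hkey]
  have e₂ : ∀ ω, Real.exp (-(s * ((∑ᶠ u ∈ (E.X δ ω).loops \ {u ∈ (E.X δ ω).loops |
      closedBall (0 : ℂ) r ⊆ {z | u.wind z ≠ 0} ∧ u.range ⊆ ball (0 : ℂ) 1}, θ u) + t * m))) =
      Real.exp (-s * (ΘF ω - mF) + -s * (ΘB ω - mB)) := fun ω ↦ by rw [hsplit ω, ← hkey, neg_mul]
  refine ⟨hI₁.congr (Eventually.of_forall fun ω ↦ (e₁ ω).symm),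
    (integral_congr_ae (Eventually.of_forall fun ω ↦ e₁ ω)).trans_le hle₁,
    hI₂.congr (Eventually.of_forall fun ω ↦ (e₂ ω).symm),
    (integral_congr_ae (Eventually.of_forall fun ω ↦ e₂ ω)).trans_le hle₂, ?_, ?_⟩
  -- (iii) `E e^{s Θ₂} ≤ M`
  · exact hI₃.mono' (Real.measurable_exp.comp (hmΘ₂.const_mul s)).aestronglyMeasurable
      (Eventually.of_forall fun ω ↦ by
        rw [Real.norm_eq_abs, abs_of_pos (Real.exp_pos _)]; exact hpt ω)
  · exact (integral_mono_of_nonneg (Eventually.of_forall fun ω ↦ (Real.exp_pos _).le) hI₃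
      (Eventually.of_forall hpt)).trans hle₃


end Summit.CriticalPhenomena.CardyFormulaZ2.Cruxes.NestingRigidity.PositiveConeWeightDoubling

end
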